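import Summits.ResolutionOfSingularities.ResolutionOfSingularities.Theorems.ConeExit.Negative.Mirror

/-!
# `ConeExit` (crux stmt-ResolutionOfSingularities-16883, route `WildCones`):
# the hypothesis `3 ≤ n` is LOAD-BEARING (negative-side support, refuter cdisprove seat; this file
# refutes nothing stated in the route — `ConeExit` carries `3 ≤ n`)

`ConeExit` (one-step cone exit lemma): for `p` odd, `n ≥ 3`, `κ` perfect of characteristic `p`, if a
state `c` of the point-blow-up calculus of `zᵖ = a(u₁ … uₙ)` is isolated of multiplicity `p` and a
successor `step i τ c` is again isolated of multiplicity `p`, then `c` has cleaned order EXACTLY `p`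
(and `dL c = 1`). Its Case-A clause ("cleaned order `> p` ⇒ no isolated multiplicity-`p` successor")
is a dimension count `dim (Sing X' ∩ E) ≥ n - 2 ≥ 1`, which needs `n ≥ 3`.

This file records, sorry-free and through the crux's OWN formal calculus (the exact mirror
`Negative/Mirror.lean`, `crux_iff`), that the bound is sharp: the right-hand side of `crux_iff` with `3 ≤ n` weakened to `2 ≤ n` and
nothing else changed is FALSE (`coneExit_false_without_N3`; stated inline, no named `Prop`).
Witness: `p = 3`, `n = 2`, `κ = 𝔽₃`, `a = u₁⁴ + u₂⁷` (isolated: `(∂a) = (u₁³, u₂⁶)`; multiplicity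
`3`; cleaned order `4`), chart `u₂`, translation `0`: the successor computed by `step` is
`u₁⁴u₂ + u₂⁴`, again isolated (`u₁⁷, u₂⁷ ∈ (u₁³u₂, u₁⁴ + u₂³)`) of multiplicity `3`, while `OrdP`
fails for the start. Isolatedness is certified in the kernel by the certificate format
`module_finite_quotient_of_X_pow_mem` of `Mirror.lean`. Moral for the provers: `stub_caseA` must use
`n - 1 ≥ 2`; at `n = 2` the locus `{a_{p+1}(1, t) = 0} ⊂ E ≅ 𝔸¹` is a point.
-/

noncomputable section

-- single-problem summit: the doubled namespace component `ResolutionOfSingularities` is forced by the tree layout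
set_option linter.dupNamespace false

namespace Summit.ResolutionOfSingularities.ResolutionOfSingularities.Theorems.ConeExit.Negative

open scoped BigOperators Classical

/-! ## The witness at `n = 2`: `u₁⁴ + u₂⁷` over `𝔽₃` and its `u₂`-chart successor `u₁⁴u₂ + u₂⁴` -/

section Witness

open MvPowerSeries

/-- The start `a = u₁⁴ + u₂⁷` (`u₁ ↔ 0`, `u₂ ↔ 1`), cleaned order `4 = p + 1`, as a coefficient
function over `𝔽₃`. [folklore] -/
def fermat : (Fin 2 → ℕ) → ZMod 3 :=
  fun A => if A 0 = 4 ∧ A 1 = 0 then 1 else if A 0 = 0 ∧ A 1 = 7 then 1 else 0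

/-- The successor `a' = u₁⁴u₂ + u₂⁴` (chart `u₂`, translation `0`), as a coefficient function over `𝔽₃`.
[folklore] -/
def fermat' : (Fin 2 → ℕ) → ZMod 3 :=
  fun A => if A 0 = 4 ∧ A 1 = 1 then 1 else if A 0 = 0 ∧ A 1 = 4 then 1 else 0

/-- Support of `u₁⁴ + u₂⁷`. [folklore] -/
lemma fermat_ne_zero_iff (A : Fin 2 → ℕ) :
    fermat A ≠ 0 ↔ (A 0 = 4 ∧ A 1 = 0) ∨ (A 0 = 0 ∧ A 1 = 7) := by
  unfold fermat
  by_cases h1 : A 0 = 4 ∧ A 1 = 0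
  · rw [if_pos h1]; exact ⟨fun _ => Or.inl h1, fun _ => by decide⟩
  · rw [if_neg h1]
    by_cases h2 : A 0 = 0 ∧ A 1 = 7
    · rw [if_pos h2]; exact ⟨fun _ => Or.inr h2, fun _ => by decide⟩
    · rw [if_neg h2]; exact ⟨fun h => absurd rfl h, fun h => (h.elim h1 h2).elim⟩

/-- Support of `u₁⁴u₂ + u₂⁴`. [folklore] -/
lemma fermat'_ne_zero_iff (A : Fin 2 → ℕ) :
    fermat' A ≠ 0 ↔ (A 0 = 4 ∧ A 1 = 1) ∨ (A 0 = 0 ∧ A 1 = 4) := by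
  unfold fermat'
  by_cases h1 : A 0 = 4 ∧ A 1 = 1
  · rw [if_pos h1]; exact ⟨fun _ => Or.inl h1, fun _ => by decide⟩
  · rw [if_neg h1]
    by_cases h2 : A 0 = 0 ∧ A 1 = 4
    · rw [if_pos h2]; exact ⟨fun _ => Or.inr h2, fun _ => by decide⟩
    · rw [if_neg h2]; exact ⟨fun h => absurd rfl h, fun h => (h.elim h1 h2).elim⟩

/-- `u₁⁴ + u₂⁷` is `3`-clean. [folklore] -/
lemma clean_fermat : clean 3 fermat = fermat := by
  funext A
  unfold clean
  split_ifs with h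
  · symm
    by_contra hne
    rcases (fermat_ne_zero_iff A).mp hne with ⟨h0, -⟩ | ⟨-, h1⟩
    · have := h 0; omega
    · have := h 1; omega
  · rfl

/-- `u₁⁴u₂ + u₂⁴` is `3`-clean. [folklore] -/
lemma clean_fermat' : clean 3 fermat' = fermat' := by
  funext A
  unfold clean
  split_ifs with h
  · symm
    by_contra hne
    rcases (fermat'_ne_zero_iff A).mp hne with ⟨h0, -⟩ | ⟨-, h1⟩
    · have := h 0; omega
    · have := h 1; omega
  · rfl

/-- The order of `u₁⁴ + u₂⁷` is at least `3` (it is `4`). [folklore] -/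
lemma three_le_ord_fermat : 3 ≤ ord fermat := by
  unfold ord
  apply le_csInf
  · refine ⟨4, ![4, 0], (fermat_ne_zero_iff _).mpr (Or.inl ⟨by simp, by simp⟩), ?_⟩
    simp [Fin.sum_univ_two]
  · rintro m ⟨A, hA, rfl⟩
    rw [Fin.sum_univ_two]
    rcases (fermat_ne_zero_iff A).mp hA with ⟨h0, h1⟩ | ⟨h0, h1⟩ <;> omega

/-- **One step of the dynamics** (chart `u₂`, translation `0`) maps `u₁⁴ + u₂⁷` to `u₁⁴u₂ + u₂⁴`:
blow-up `u₁ ↦ u₁u₂` gives `u₁⁴u₂⁴ + u₂⁷`, dividing by `u₂³` gives `u₁⁴u₂ + u₂⁴`, already clean. [folklore] -/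
lemma step_fermat : step 3 (1 : Fin 2) (0 : Fin 2 → ZMod 3) fermat = fermat' := by
  unfold step
  rw [clean_fermat, if_pos three_le_ord_fermat, tr_zero]
  funext B
  have hsum : ∀ B : Fin 2 → ℕ, Finset.sum (Finset.univ.erase (1 : Fin 2)) (fun j => B j) = B 0 := by
    intro B
    have : (Finset.univ.erase (1 : Fin 2)) = {0} := by decide
    rw [this, Finset.sum_singleton]
  have h01 : (0 : Fin 2) ≠ 1 := by decide
  unfold clean dv bl fermat fermat'
  simp only [hsum, Function.update_self, Function.update_of_ne h01, Fin.forall_fin_two]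
  split_ifs <;> first | rfl | omega

/-- `u₁⁴ + u₂⁷` has multiplicity `3`. [folklore] -/
lemma multP_fermat : (∃ A, clean 3 fermat A ≠ 0) ∧
    ∀ A, clean 3 fermat A ≠ 0 → 3 ≤ Finset.sum Finset.univ (fun j => A j) := by
  rw [clean_fermat]
  refine ⟨⟨![4, 0], (fermat_ne_zero_iff _).mpr (Or.inl ⟨by simp, by simp⟩)⟩, ?_⟩
  intro A hA
  rw [Fin.sum_univ_two]
  rcases (fermat_ne_zero_iff A).mp hA with ⟨h0, h1⟩ | ⟨h0, h1⟩ <;> omega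

/-- `u₁⁴u₂ + u₂⁴` has multiplicity `3`. [folklore] -/
lemma multP_fermat' : (∃ A, clean 3 fermat' A ≠ 0) ∧
    ∀ A, clean 3 fermat' A ≠ 0 → 3 ≤ Finset.sum Finset.univ (fun j => A j) := by
  rw [clean_fermat']
  refine ⟨⟨![4, 1], (fermat'_ne_zero_iff _).mpr (Or.inl ⟨by simp, by simp⟩)⟩, ?_⟩
  intro A hA
  rw [Fin.sum_univ_two]
  rcases (fermat'_ne_zero_iff A).mp hA with ⟨h0, h1⟩ | ⟨h0, h1⟩ <;> omega

/-- `u₁⁴ + u₂⁷` does NOT have cleaned order exactly `3`. [folklore] -/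
lemma not_ordP_fermat : ¬ ∃ A, clean 3 fermat A ≠ 0 ∧ Finset.sum Finset.univ (fun j => A j) = 3 := by
  rw [clean_fermat]
  rintro ⟨A, hA, hs⟩
  rw [Fin.sum_univ_two] at hs
  rcases (fermat_ne_zero_iff A).mp hA with ⟨h0, h1⟩ | ⟨h0, h1⟩ <;> omega

/-- `∂₁(u₁⁴ + u₂⁷) = u₁³` over `𝔽₃`. [folklore] -/
lemma pd0_fermat : pd 0 (ser 3 fermat) = (X 0 : MvPowerSeries (Fin 2) (ZMod 3)) ^ 3 := by
  ext A
  rw [coeff_pd_ser, coeff_ser, clean_fermat, coeff_X_pow]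
  have e0 : (A + Finsupp.single (0 : Fin 2) 1 : Fin 2 →₀ ℕ) 0 = A 0 + 1 := by simp
  have e1 : (A + Finsupp.single (0 : Fin 2) 1 : Fin 2 →₀ ℕ) 1 = A 1 := by simp
  have hA : A = Finsupp.single 0 3 ↔ A 0 = 3 ∧ A 1 = 0 := by
    constructor
    · intro h; subst h; simp
    · rintro ⟨h0, h1⟩; ext j; fin_cases j <;> simp [h0, h1]
  unfold fermat
  simp only [e0, e1]
  by_cases h : A 0 = 3 ∧ A 1 = 0
  · rw [if_pos (hA.mpr h), if_pos (show A 0 + 1 = 4 ∧ A 1 = 0 by omega), h.1]; decide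
  · rw [if_neg (fun h' => h (hA.mp h')), if_neg (show ¬ (A 0 + 1 = 4 ∧ A 1 = 0) by omega),
      if_neg (show ¬ (A 0 + 1 = 0 ∧ A 1 = 7) by omega), mul_zero]

/-- `∂₂(u₁⁴ + u₂⁷) = u₂⁶` over `𝔽₃`. [folklore] -/
lemma pd1_fermat : pd 1 (ser 3 fermat) = (X 1 : MvPowerSeries (Fin 2) (ZMod 3)) ^ 6 := by
  ext A
  rw [coeff_pd_ser, coeff_ser, clean_fermat, coeff_X_pow]
  have e0 : (A + Finsupp.single (1 : Fin 2) 1 : Fin 2 →₀ ℕ) 0 = A 0 := by simp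
  have e1 : (A + Finsupp.single (1 : Fin 2) 1 : Fin 2 →₀ ℕ) 1 = A 1 + 1 := by simp
  have hA : A = Finsupp.single 1 6 ↔ A 0 = 0 ∧ A 1 = 6 := by
    constructor
    · intro h; subst h; simp
    · rintro ⟨h0, h1⟩; ext j; fin_cases j <;> simp [h0, h1]
  unfold fermat
  simp only [e0, e1]
  by_cases h : A 0 = 0 ∧ A 1 = 6
  · rw [if_pos (hA.mpr h), if_neg (show ¬ (A 0 = 4 ∧ A 1 + 1 = 0) by omega),
      if_pos (show A 0 = 0 ∧ A 1 + 1 = 7 by omega), h.2]; decide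
  · rw [if_neg (fun h' => h (hA.mp h')), if_neg (show ¬ (A 0 = 4 ∧ A 1 + 1 = 0) by omega),
      if_neg (show ¬ (A 0 = 0 ∧ A 1 + 1 = 7) by omega), mul_zero]

/-- `∂₁(u₁⁴u₂ + u₂⁴) = u₁³u₂` over `𝔽₃`. [folklore] -/
lemma pd0_fermat' : pd 0 (ser 3 fermat') = (X 0 : MvPowerSeries (Fin 2) (ZMod 3)) ^ 3 * X 1 := by
  ext A
  rw [coeff_pd_ser, coeff_ser, clean_fermat', show (X 1 : MvPowerSeries (Fin 2) (ZMod 3)) = X 1 ^ 1 from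
    (pow_one _).symm, X_pow_eq, X_pow_eq, monomial_mul_monomial, one_mul, coeff_monomial]
  have e0 : (A + Finsupp.single (0 : Fin 2) 1 : Fin 2 →₀ ℕ) 0 = A 0 + 1 := by simp
  have e1 : (A + Finsupp.single (0 : Fin 2) 1 : Fin 2 →₀ ℕ) 1 = A 1 := by simp
  have hA : A = Finsupp.single 0 3 + Finsupp.single 1 1 ↔ A 0 = 3 ∧ A 1 = 1 := by
    constructor
    · intro h; subst h; simp
    · rintro ⟨h0, h1⟩; ext j; fin_cases j <;> simp [h0, h1]
  unfold fermat'
  simp only [e0, e1]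
  by_cases h : A 0 = 3 ∧ A 1 = 1
  · rw [if_pos (hA.mpr h), if_pos (show A 0 + 1 = 4 ∧ A 1 = 1 by omega), h.1]; decide
  · rw [if_neg (fun h' => h (hA.mp h')), if_neg (show ¬ (A 0 + 1 = 4 ∧ A 1 = 1) by omega),
      if_neg (show ¬ (A 0 + 1 = 0 ∧ A 1 = 4) by omega), mul_zero]

/-- `∂₂(u₁⁴u₂ + u₂⁴) = u₁⁴ + u₂³` over `𝔽₃`. [folklore] -/
lemma pd1_fermat' : pd 1 (ser 3 fermat') = (X 0 : MvPowerSeries (Fin 2) (ZMod 3)) ^ 4 + X 1 ^ 3 := by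
  ext A
  rw [coeff_pd_ser, coeff_ser, clean_fermat', map_add, coeff_X_pow, coeff_X_pow]
  have e0 : (A + Finsupp.single (1 : Fin 2) 1 : Fin 2 →₀ ℕ) 0 = A 0 := by simp
  have e1 : (A + Finsupp.single (1 : Fin 2) 1 : Fin 2 →₀ ℕ) 1 = A 1 + 1 := by simp
  have hA : A = Finsupp.single 0 4 ↔ A 0 = 4 ∧ A 1 = 0 := by
    constructor
    · intro h; subst h; simp
    · rintro ⟨h0, h1⟩; ext j; fin_cases j <;> simp [h0, h1]
  have hA' : A = Finsupp.single 1 3 ↔ A 0 = 0 ∧ A 1 = 3 := by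
    constructor
    · intro h; subst h; simp
    · rintro ⟨h0, h1⟩; ext j; fin_cases j <;> simp [h0, h1]
  unfold fermat'
  simp only [e0, e1]
  by_cases h : A 0 = 4 ∧ A 1 = 0
  · rw [if_pos (hA.mpr h), if_neg (show ¬ (A = Finsupp.single 1 3) from fun h' => by
        have := hA'.mp h'; omega),
      if_pos (show A 0 = 4 ∧ A 1 + 1 = 1 by omega), h.2]; decide
  · by_cases h' : A 0 = 0 ∧ A 1 = 3
    · rw [if_neg (fun h'' => h (hA.mp h'')), if_pos (hA'.mpr h'),
        if_neg (show ¬ (A 0 = 4 ∧ A 1 + 1 = 1) by omega),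
        if_pos (show A 0 = 0 ∧ A 1 + 1 = 4 by omega), h'.2]; decide
    · rw [if_neg (fun h'' => h (hA.mp h'')), if_neg (fun h'' => h' (hA'.mp h'')),
        if_neg (show ¬ (A 0 = 4 ∧ A 1 + 1 = 1) by omega),
        if_neg (show ¬ (A 0 = 0 ∧ A 1 + 1 = 4) by omega), mul_zero, add_zero]

/-- **`u₁⁴ + u₂⁷` is ISOLATED**: `u₁⁶, u₂⁶ ∈ (∂a) = (u₁³, u₂⁶)`. [folklore] -/
lemma isol_fermat : Module.Finite (ZMod 3) (MvPowerSeries (Fin 2) (ZMod 3) ⧸ jac 3 fermat) := by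
  have h0 : (X 0 : MvPowerSeries (Fin 2) (ZMod 3)) ^ 3 ∈ jac 3 fermat := by
    rw [← pd0_fermat]; exact Ideal.subset_span ⟨0, rfl⟩
  have h1 : (X 1 : MvPowerSeries (Fin 2) (ZMod 3)) ^ 6 ∈ jac 3 fermat := by
    rw [← pd1_fermat]; exact Ideal.subset_span ⟨1, rfl⟩
  apply module_finite_quotient_of_X_pow_mem _ 6
  intro k
  fin_cases k
  · show (X 0 : MvPowerSeries (Fin 2) (ZMod 3)) ^ 6 ∈ jac 3 fermat
    rw [show (X 0 : MvPowerSeries (Fin 2) (ZMod 3)) ^ 6 = X 0 ^ 3 * X 0 ^ 3 from by ring]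
    exact Ideal.mul_mem_left _ _ h0
  · exact h1

/-- **`u₁⁴u₂ + u₂⁴` is ISOLATED**: with `g₀ = u₁³u₂`, `g₁ = u₁⁴ + u₂³` one has
`u₁⁷ = u₁³g₁ - u₂²g₀` and `u₂⁷ = u₂³(u₂g₁ - u₁g₀)`. [folklore] -/
lemma isol_fermat' : Module.Finite (ZMod 3) (MvPowerSeries (Fin 2) (ZMod 3) ⧸ jac 3 fermat') := by
  have h0 : (X 0 : MvPowerSeries (Fin 2) (ZMod 3)) ^ 3 * X 1 ∈ jac 3 fermat' := by
    rw [← pd0_fermat']; exact Ideal.subset_span ⟨0, rfl⟩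
  have h1 : (X 0 : MvPowerSeries (Fin 2) (ZMod 3)) ^ 4 + X 1 ^ 3 ∈ jac 3 fermat' := by
    rw [← pd1_fermat']; exact Ideal.subset_span ⟨1, rfl⟩
  apply module_finite_quotient_of_X_pow_mem _ 7
  intro k
  fin_cases k
  · show (X 0 : MvPowerSeries (Fin 2) (ZMod 3)) ^ 7 ∈ jac 3 fermat'
    rw [show (X 0 : MvPowerSeries (Fin 2) (ZMod 3)) ^ 7 =
      X 0 ^ 3 * (X 0 ^ 4 + X 1 ^ 3) - X 1 ^ 2 * (X 0 ^ 3 * X 1) from by ring]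
    exact Ideal.sub_mem _ (Ideal.mul_mem_left _ _ h1) (Ideal.mul_mem_left _ _ h0)
  · show (X 1 : MvPowerSeries (Fin 2) (ZMod 3)) ^ 7 ∈ jac 3 fermat'
    rw [show (X 1 : MvPowerSeries (Fin 2) (ZMod 3)) ^ 7 =
      X 1 ^ 3 * (X 1 * (X 0 ^ 4 + X 1 ^ 3) - X 0 * (X 0 ^ 3 * X 1)) from by ring]
    exact Ideal.mul_mem_left _ _
      (Ideal.sub_mem _ (Ideal.mul_mem_left _ _ h1) (Ideal.mul_mem_left _ _ h0))

end Witness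

/-- **`3 ≤ n` is load-bearing in `ConeExit`.** The negated proposition is the right-hand side of
`crux_iff` (`Negative/Mirror.lean`) with `3 ≤ n` replaced by `2 ≤ n` and nothing else changed; it is false at
`(p, n, κ) = (3, 2, 𝔽₃)`: the start `u₁⁴ + u₂⁷` and its `u₂`-chart successor `u₁⁴u₂ + u₂⁴` are both
isolated of multiplicity `3`, but the start has cleaned order `4 ≠ 3`. Any proof of the crux (indeed of
its Case-A clause `stub_caseA`) must use `n - 1 ≥ 2`. [folklore] -/
theorem coneExit_false_without_N3 :
    ¬ ∀ p : ℕ, p.Prime → p ≠ 2 → ∀ n : ℕ, 2 ≤ n → ∀ (κ : Type) [Field κ] [CharP κ p] [PerfectField κ]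
        (c : (Fin n → ℕ) → κ) (i : Fin n) (τ : Fin n → κ),
        Module.Finite κ (MvPowerSeries (Fin n) κ ⧸ jac p c) →
        ((∃ A, clean p c A ≠ 0) ∧ ∀ A, clean p c A ≠ 0 → p ≤ Finset.sum Finset.univ (fun j => A j)) →
        Module.Finite κ (MvPowerSeries (Fin n) κ ⧸ jac p (step p i τ c)) →
        ((∃ A, clean p (step p i τ c) A ≠ 0) ∧
          ∀ A, clean p (step p i τ c) A ≠ 0 → p ≤ Finset.sum Finset.univ (fun j => A j)) →
        (∃ A, clean p c A ≠ 0 ∧ Finset.sum Finset.univ (fun j => A j) = p) ∧ dL p c = 1 := by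
  intro h
  have key := h 3 Nat.prime_three (by norm_num) 2 le_rfl (ZMod 3) fermat 1 0 isol_fermat multP_fermat
    (by rw [step_fermat]; exact isol_fermat') (by rw [step_fermat]; exact multP_fermat')
  exact not_ordP_fermat key.1

/-- The same fact, phrased against the crux by name: `ConeExit` restricted to its own hypotheses but
with `n = 2` admitted would fail; equivalently, the `n = 2` instance of the crux's body is false.
[folklore] -/
theorem coneExit_body_false_at_n2 :
    ¬ ∀ (κ : Type) [Field κ] [CharP κ 3] [PerfectField κ]
        (c : (Fin 2 → ℕ) → κ) (i : Fin 2) (τ : Fin 2 → κ),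
        Module.Finite κ (MvPowerSeries (Fin 2) κ ⧸ jac 3 c) →
        ((∃ A, clean 3 c A ≠ 0) ∧ ∀ A, clean 3 c A ≠ 0 → 3 ≤ Finset.sum Finset.univ (fun j => A j)) →
        Module.Finite κ (MvPowerSeries (Fin 2) κ ⧸ jac 3 (step 3 i τ c)) →
        ((∃ A, clean 3 (step 3 i τ c) A ≠ 0) ∧
          ∀ A, clean 3 (step 3 i τ c) A ≠ 0 → 3 ≤ Finset.sum Finset.univ (fun j => A j)) →
        (∃ A, clean 3 c A ≠ 0 ∧ Finset.sum Finset.univ (fun j => A j) = 3) ∧ dL 3 c = 1 := by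
  intro h
  have key := h (ZMod 3) fermat 1 0 isol_fermat multP_fermat
    (by rw [step_fermat]; exact isol_fermat') (by rw [step_fermat]; exact multP_fermat')
  exact not_ordP_fermat key.1

end Summit.ResolutionOfSingularities.ResolutionOfSingularities.Theorems.ConeExit.Negative

end
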